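import Summits.Langlands.Langlands.Theorems.IrreducibilityBySelfDualityPairLBoundaryJSOfCornerRoad
import Summits.Langlands.Langlands.Theorems.IrreducibilityBySelfDualityPairLBoundaryJSGapGlobalTranslate
import Summits.Langlands.Langlands.Theorems.IrreducibilityBySelfDualityPairLBoundaryJSGapLocalControlAsm

/-!
# Crux `PairLBoundaryJS` (stmt-Langlands-13622), line `Sketch` — the crux from FOUR named facts by the GAP ROAD
# (lead c6): Mœglin–Waldspurger (i)(a) for `m + 2 ≤ n` is no longer an input

Summit `Langlands`, sub-problem `Langlands`, helper file under `Theorems/` supporting the crux `PairLBoundaryJS` =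
Arthur–Clozel (1989), Ch. 3, (2.2) for cuspidal Borel–Jacquet data on `GL_n × GL_m` over a number field, all ranks.
With respect to `PairLBoundaryJSOfCornerRoad.stub_PairLBoundaryJS_of_gap_of_humphriesJo_of_jacquet` (lead c5: inputs
`{MW (i)(a) for m + 2 ≤ n, hHJ, hJ}`), the input MW (i)(a) for `m + 2 ≤ n` (Mœglin–Waldspurger (1989), Appendice,
Corollaire (i)(a); Cogdell (2004), Thm. 4.2) is now PROVED granted two smaller printed facts, by the gap road — the
`GL_n × GL_m` Rankin–Selberg integrals of Jacquet–Piatetski-Shapiro–Shalika with Cogdell's projector, Euler-factorised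
at general corank (`GapPairEuler`, `GapEulerLimit`, `HonestTranslateUnramified`), absolutely convergent in one factor
(`GapAbsMajorant`, `GapAbsConvergence`), in translate form (`GapGlobalTranslate`), with the bad-place and archimedean
local control (`GapUnitBoxProductForm`, `GapLocalSingleDatum`, `GapArchFactorData`, `GapLocalControlAsm`):

* `hA` — the archimedean named fact `JacquetShalika1990_archRankinSelbergGap_entireRatio` (Jacquet (2009), Thm. 2.1
  (i)(ii), Thm. 2.6 (i), Prop. 12.5 (ii); Cogdell (2004), Thm. 3.5, §4.2: `K_∞`-finite entire-ratio control for
  `(n, m)`, `m < n`);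
* `hE` — the global-analytic named fact `Cogdell2004_unfoldedPairIntegral_entire` (Cogdell (2004), Thm. 2.1, analytic
  clause: the unfolded global torus integral of two honest cusp forms admits an entire continuation).

The crux is then `PairLBoundaryJS_of_four_facts hHJ hJ hA hE` — conditional on four printed theorems, three of them
archimedean-local and one global-analytic, and on nothing else.

## References

* J. Arthur, L. Clozel, *Simple algebras, base change, and the advanced theory of the trace formula*, Ann. of
  Math. Stud. 120 (1989), Ch. 3 §2 (2.2) [ArthurClozelAMS120].
* C. Mœglin, J.-L. Waldspurger, *Le spectre résiduel de GL(n)*, Ann. Sci. ÉNS 22 (1989), Appendice, p. 667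
  [MoeglinWaldspurger1989].
* J. W. Cogdell, *Analytic theory of L-functions for GL_n* (2004), §2.2, Thm. 2.1–2.2, Thm. 4.2, §4.2
  [CogdellAnalyticTheory2004].
* H. Jacquet, *Archimedean Rankin–Selberg integrals* (2009), Thm. 2.1, Thm. 2.6, Prop. 12.5 [JacquetArchimedeanRS2009].
-/

noncomputable section

-- `Summit.Langlands.Langlands.…` (summit = sub-problem name, D-0017 layout) trips `dupNamespace`
set_option linter.dupNamespace false

open scoped MatrixGroups Topology Pointwise ENNReal NNReal ComplexConjugate InnerProductSpace ContDiff
-- the place subtypes indexing `mixedSpace K` are `Fintype` classically (`NormedCommRing (mixedSpace K)`)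
open scoped Classical Matrix.Norms.Operator
open NumberField IsDedekindDomain MeasureTheory Measure Matrix Set Filter WithZero
open NumberField.mixedEmbedding
open Literature.NumberTheory.Automorphic AdelicGroupData
open Literature.NumberTheory.GaloisRepresentations (ideleGroup HeckeCharacter)
open Literature.MeasureTheory.Group
open Literature.RingTheory.SymmetricFunctions.SymmPoly
open ValuativeRel

-- the automorphic quotient carries the tree's Borel σ-algebra, not Mathlib's quotient σ-algebra
attribute [-instance] Quotient.instMeasurableSpace QuotientGroup.measurableSpace

-- the house local instances, exactly as in `RankinSelbergUnfoldingIdentity`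
attribute [local instance] adelicBorel borelSpace_adelic locallyCompactSpace_adelic secondCountableTopology_gl_adelic
  glAdeleBorel borelSpace_glAdele borelSpace_ideleGroup secondCountableTopology_ideleGroup

-- Mathlib idiom: the commutator Lie ring on matrices, to mention `(archGroupGL n K).lie`
attribute [local instance 100] LieRing.ofAssociativeRing

namespace Summit.Langlands.Langlands.Theorems.PairLBoundaryJSOfGapRoad

/-- **The gap heart.** For cuspidal `π` on `GL_n`, `σ` on `GL_m` (`0 < m < n`), a finite `S₀` off which both are
unramified, Satake families `α₀`, `β₀` off `S₀` and any `s₀` (shift `h = (n-m)/2`): with the local control at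
`(π, σ̄, S₀)` targeted at `s₀ - h` (`τ`, `T`, data `(c_i, Φ_i, Φ'_i)`, `Λ`, `hh`) and the entire functions `J_i` of
the global translate theorem at `(π, σ̄, γ = β̄₀)`, `J := Λ(s - h) Σ_i c_i J_i(s - h)` is entire,
`A := w_{s-h}(τ) · hh(s - h)` is entire with `A(s₀) ≠ 0` (`torusWeightC_ne_zero`), and `J = A · L^{S₀}(s, α₀ ⊗ β₀)`
on a right half-plane (`IsSatakeFamilyOf.conj`, `isUnramifiedAt_conj_iff`, `multiset_map_conj_map_conj`,
`exists_univ_val_map_eq`). [cite: CogdellAnalyticTheory2004, Thm. 4.2 and §4.2] -/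
theorem gap_entire_quotient_of_local_control
    (hA : ∀ (N M : ℕ) (K : Type) [Field K] [NumberField K], JacquetShalika1990_archRankinSelbergGap_entireRatio N M K)
    (hE : ∀ (N M : ℕ) (K : Type) [Field K] [NumberField K], Cogdell2004_unfoldedPairIntegral_entire N M K) :
    ∀ {n m : ℕ} {K : Type} [Field K] [NumberField K]
      {μ : Measure (gl n K).automorphicQuotient} [(gl n K).IsAutomorphicMeasure μ]
      {μ' : Measure (gl m K).automorphicQuotient} [(gl m K).IsAutomorphicMeasure μ']
      (_hm : 0 < m) (hmn : m < n) (P : CuspidalAutomorphicRepGL n K μ) (P' : CuspidalAutomorphicRepGL m K μ')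
      (S₀ : Finset (HeightOneSpectrum (𝓞 K)))
      (_hS₀ : ∀ v ∉ S₀, IsUnramifiedAt P.1 v ∧ IsUnramifiedAt P'.1 v)
      {α₀ β₀ : SatakeFamily K} (_hα₀ : IsSatakeFamilyOf P (↑S₀ : Set (HeightOneSpectrum (𝓞 K))) α₀)
      (_hβ₀ : IsSatakeFamilyOf P' (↑S₀ : Set (HeightOneSpectrum (𝓞 K))) β₀) (s₀ : ℂ),
      ∃ (x₀ : ℝ) (J A : ℂ → ℂ), Differentiable ℂ J ∧ Differentiable ℂ A ∧ A s₀ ≠ 0 ∧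
        ∀ s : ℂ, x₀ < s.re → J s = A s * partialPairL (↑S₀ : Set (HeightOneSpectrum (𝓞 K))) α₀ β₀ s := by
  intro n m K _ _ μ _ μ' _ hm hmn P P' S₀ hS₀ α₀ β₀ hα₀ hβ₀ s₀
  classical
  -- instances, as in `corner_entire_quotient_of_local_control`
  haveI : T2Space (AdeleRing (𝓞 K) K) := t2Space_adeleRing K
  letI : MeasurableSpace (AdeleRing (𝓞 K) K) := borel _
  haveI : BorelSpace (AdeleRing (𝓞 K) K) := ⟨rfl⟩
  haveI := borelSpace_ideleGroup K
  haveI := locallyCompactSpace_ideleGroup K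
  haveI := secondCountableTopology_ideleGroup K
  haveI := secondCountableTopology_adeleRing K
  haveI := locallyCompactSpace_adeleRing' K
  haveI : T2Space (GL (Fin n) (AdeleRing (𝓞 K) K)) := t2Space_gl n K
  haveI : T2Space (GL (Fin m) (AdeleRing (𝓞 K) K)) := t2Space_gl m K
  haveI : LocallyCompactSpace (GL (Fin n) (AdeleRing (𝓞 K) K)) :=
    AdelicGroupData.locallyCompactSpace_generalLinearGroup_adeleRing K (Fin n)
  haveI : LocallyCompactSpace (GL (Fin m) (AdeleRing (𝓞 K) K)) :=
    AdelicGroupData.locallyCompactSpace_generalLinearGroup_adeleRing K (Fin m)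
  haveI := secondCountableTopology_generalLinearGroup_adeleRing K (Fin n)
  haveI := secondCountableTopology_generalLinearGroup_adeleRing K (Fin m)
  haveI : CompactSpace ↥(maximalCompactAdelic m K) :=
    isCompact_iff_compactSpace.1 (isCompact_maximalCompactAdelic m K)
  haveI : LocallyCompactSpace ↥(adelicUnipotent n K) := (isClosed_adelicUnipotent n K).locallyCompactSpace
  haveI : LocallyCompactSpace ↥(adelicUnipotent m K) := (isClosed_adelicUnipotent m K).locallyCompactSpace
  -- Haar measures
  obtain ⟨νA, hνA⟩ : ∃ ν : Measure (Fin m → ideleGroup K), IsHaarMeasure ν := ⟨Measure.haar, inferInstance⟩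
  obtain ⟨νK, hνK⟩ : ∃ ν : Measure ↥(maximalCompactAdelic m K), IsHaarMeasure ν := ⟨Measure.haar, inferInstance⟩
  obtain ⟨ν₀, hν₀⟩ : ∃ ν : Measure ↥(adelicUnipotent n K), IsHaarMeasure ν := ⟨Measure.haar, inferInstance⟩
  obtain ⟨ν₀', hν₀'⟩ : ∃ ν : Measure ↥(adelicUnipotent m K), IsHaarMeasure ν := ⟨Measure.haar, inferInstance⟩
  -- `π` and `σ̄` are unramified off `S₀`
  have hU : ∀ v ∉ S₀, IsUnramifiedAt P.1 v ∧ IsUnramifiedAt P'.conj.1 v := fun v hv =>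
    ⟨(hS₀ v hv).1, isUnramifiedAt_conj_iff.2 (hS₀ v hv).2⟩
  -- the shift between the torus parameter and the `L`-parameter
  set sh : ℂ := ((n : ℂ) - (m : ℂ)) / 2 with hsh
  -- the local control datum at `(π, σ̄, S₀)`, targeted at `s₀ - sh`
  obtain ⟨τ, T, hTτ, hTinf, hTψ, hτψ, k, c, Φ, Φ', sv, sv', 𝔫₀, h𝔫₀, h𝔫₀S, hΦc, hΦ'c, hae, hae', hΦcusp, hΦ'cusp,
    hΦU, hΦ'U, Λ, hh, x₁, hΛ, hhh, hh0, hΛsum⟩ :=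
    GapLocalControlAsm.stub_gap_local_control hA hm hmn νA νK ν₀ ν₀' P P'.conj S₀ hU (s₀ - sh)
  have hS' : ∀ v ∉ (↑S₀ : Set (HeightOneSpectrum (𝓞 K))), ¬ v.asIdeal ∣ 𝔫₀ := fun v hv h =>
    hv (Finset.mem_coe.2 (h𝔫₀S v h))
  -- enumerations of the Satake parameters of `π`, `σ̄` off `S₀`
  have hexx : ∀ v : HeightOneSpectrum (𝓞 K), ∃ x : Fin n → ℂ, v ∉ (↑S₀ : Set (HeightOneSpectrum (𝓞 K))) →
      (Finset.univ : Finset (Fin n)).val.map x = α₀ v := by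
    intro v
    by_cases hv : v ∉ (↑S₀ : Set (HeightOneSpectrum (𝓞 K)))
    · obtain ⟨x, hx⟩ := exists_univ_val_map_eq (hα₀.card_eq hv)
      exact ⟨x, fun _ => hx⟩
    · exact ⟨fun _ => 0, fun h => absurd h hv⟩
  have hexy : ∀ v : HeightOneSpectrum (𝓞 K), ∃ y : Fin m → ℂ, v ∉ (↑S₀ : Set (HeightOneSpectrum (𝓞 K))) →
      (Finset.univ : Finset (Fin m)).val.map y = (β₀ v).map conj := by
    intro v
    by_cases hv : v ∉ (↑S₀ : Set (HeightOneSpectrum (𝓞 K)))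
    · obtain ⟨y, hy⟩ := exists_univ_val_map_eq (R := ℂ) (m := m) (α := (β₀ v).map conj)
        (by rw [Multiset.card_map]; exact hβ₀.card_eq hv)
      exact ⟨y, fun _ => hy⟩
    · exact ⟨fun _ => 0, fun h => absurd h hv⟩
  choose x hx using hexx
  choose y hy using hexy
  have hββ : (fun v => ((β₀ v).map conj).map conj) = β₀ := funext fun v => multiset_map_conj_map_conj _
  -- the translate identities, one entire function for each datum
  choose xf J hJd hJ using fun i : Fin k =>
    GapGlobalTranslate.stub_gap_global_translate hm hmn (hE n m K) μ μ' νA νK ν₀ ν₀' P P'.conj hα₀ hβ₀.conj (hΦc i) (hΦ'c i)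
      (sv i) (sv' i) (hae i) (hae' i) (hΦcusp i) (hΦ'cusp i) h𝔫₀ (hΦU i) (hΦ'U i) Set.Subset.rfl hS' τ T hTτ
      hTinf (fun v hv => hTψ v fun h => hv (Finset.mem_coe.2 h)) (fun v hv => hτψ v fun h => hv (Finset.mem_coe.2 h))
      hx hy
  -- the entire functions
  set xmax : ℝ := (∑ i, |xf i|) + |x₁| + |sh.re| + 1 with hxmax
  refine ⟨xmax, fun s => Λ (s - sh) * ∑ i, c i * J i (s - sh),
    fun s => torusWeightC m K (s - sh) τ * hh (s - sh), ?_, ?_, ?_, ?_⟩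
  · -- `J` is entire
    have hΛ' : Differentiable ℂ fun s : ℂ => Λ (s - sh) := hΛ.comp (differentiable_id.sub_const _)
    have hI : ∀ i, Differentiable ℂ fun s : ℂ => J i (s - sh) := fun i =>
      (hJd i).comp (differentiable_id.sub_const _)
    have hsum : Differentiable ℂ fun s => ∑ i, c i * J i (s - sh) := by
      have h : Differentiable ℂ (∑ i, fun s => c i * J i (s - sh)) :=
        Differentiable.sum fun i _ => (hI i).const_mul (c i)
      convert h using 1
      funext s
      simp only [Finset.sum_apply]
    exact hΛ'.mul hsum
  · -- `A` is entire
    exact ((differentiable_torusWeightC τ).comp (differentiable_id.sub_const _)).mul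
      (hhh.comp (differentiable_id.sub_const _))
  · -- `A s₀ ≠ 0`
    exact mul_ne_zero (torusWeightC_ne_zero _ τ) hh0
  · -- the identity on `re s > xmax`
    intro s hs
    have hshre : (s - sh).re = s.re - sh.re := by simp only [Complex.sub_re]
    have habs : ∀ i, xf i < (s - sh).re := fun i => by
      have h1 : xf i ≤ |xf i| := le_abs_self _
      have h2 : |xf i| ≤ ∑ j, |xf j| := Finset.single_le_sum (fun j _ => abs_nonneg (xf j)) (Finset.mem_univ i)
      have h3 : (0 : ℝ) ≤ |x₁| := abs_nonneg _
      have h4 : sh.re ≤ |sh.re| := le_abs_self _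
      rw [hshre]; linarith
    have hs₁ : x₁ < (s - sh).re := by
      have h1 : x₁ ≤ |x₁| := le_abs_self _
      have h2 : (0 : ℝ) ≤ ∑ j, |xf j| := Finset.sum_nonneg fun j _ => abs_nonneg (xf j)
      have h4 : sh.re ≤ |sh.re| := le_abs_self _
      rw [hshre]; linarith
    have hloc := hΛsum (s - sh) hs₁
    have e1 : s - sh + sh = s := sub_add_cancel s sh
    -- each entire function on the half-plane
    have hterm : ∀ i, J i (s - sh) =
        torusWeightC m K (s - sh) τ *
          (partialPairL (↑S₀ : Set (HeightOneSpectrum (𝓞 K))) α₀ β₀ s *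
            ∫ p in unitBox {v | v ∉ (↑S₀ : Set (HeightOneSpectrum (𝓞 K)))} ×ˢ Set.univ, torusPairIntegrandC m K
              (fun g => whittakerCoeff ν₀ (unipotentTateDomain n K) (adeleAddChar K)
                (invQuot (AdelicGroupData.gl n K) (Φ i))
                (glDiagonal n (AdeleRing (𝓞 K) K) T * glCorner (AdeleRing (𝓞 K) K) hmn.le g))
              (fun g => star (whittakerCoeff ν₀' (unipotentTateDomain m K) (adeleAddChar K)
                (invQuot (AdelicGroupData.gl m K) (Φ' i)) (glDiagonal m (AdeleRing (𝓞 K) K) τ * g)))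
              (fun _ => (1 : ℝ)) (s - sh) p ∂(νA.prod νK)) := by
      intro i
      have h := hJ i (s - sh) (habs i)
      rw [hββ, e1] at h
      exact h
    simp_rw [hterm]
    -- `Λ · ∑ c_i (w L Ψ_i) = w L · (Λ ∑ c_i Ψ_i) = w L hh`
    have hre : ∑ i, c i * (torusWeightC m K (s - sh) τ *
        (partialPairL (↑S₀ : Set (HeightOneSpectrum (𝓞 K))) α₀ β₀ s *
          ∫ p in unitBox {v | v ∉ (↑S₀ : Set (HeightOneSpectrum (𝓞 K)))} ×ˢ Set.univ, torusPairIntegrandC m K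
            (fun g => whittakerCoeff ν₀ (unipotentTateDomain n K) (adeleAddChar K)
              (invQuot (AdelicGroupData.gl n K) (Φ i))
              (glDiagonal n (AdeleRing (𝓞 K) K) T * glCorner (AdeleRing (𝓞 K) K) hmn.le g))
            (fun g => star (whittakerCoeff ν₀' (unipotentTateDomain m K) (adeleAddChar K)
              (invQuot (AdelicGroupData.gl m K) (Φ' i)) (glDiagonal m (AdeleRing (𝓞 K) K) τ * g)))
            (fun _ => (1 : ℝ)) (s - sh) p ∂(νA.prod νK))) =
      torusWeightC m K (s - sh) τ * partialPairL (↑S₀ : Set (HeightOneSpectrum (𝓞 K))) α₀ β₀ s *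
        ∑ i, c i * ∫ p in unitBox {v | v ∉ (↑S₀ : Set (HeightOneSpectrum (𝓞 K)))} ×ˢ Set.univ, torusPairIntegrandC m K
            (fun g => whittakerCoeff ν₀ (unipotentTateDomain n K) (adeleAddChar K)
              (invQuot (AdelicGroupData.gl n K) (Φ i))
              (glDiagonal n (AdeleRing (𝓞 K) K) T * glCorner (AdeleRing (𝓞 K) K) hmn.le g))
            (fun g => star (whittakerCoeff ν₀' (unipotentTateDomain m K) (adeleAddChar K)
              (invQuot (AdelicGroupData.gl m K) (Φ' i)) (glDiagonal m (AdeleRing (𝓞 K) K) τ * g)))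
            (fun _ => (1 : ℝ)) (s - sh) p ∂(νA.prod νK) := by
      rw [Finset.mul_sum]
      refine Finset.sum_congr rfl fun i _ => ?_
      ring
    rw [hre]
    linear_combination (torusWeightC m K (s - sh) τ *
      partialPairL (↑S₀ : Set (HeightOneSpectrum (𝓞 K))) α₀ β₀ s) * hloc

/-! ### Mœglin–Waldspurger (i)(a) for `m + 2 ≤ n` from the gap heart -/

/-- **The gap case `m + 2 ≤ n` of Mœglin–Waldspurger (i)(a)** from `gap_entire_quotient_of_local_control` (granted
the two named facts): the ramified set `S₀` of the pair with its canonical Satake families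
(`exists_isSatakeFamilyOf_pair_ramified`), the abscissa made uniform (`x₀ := 1`) by the identity theorem
(`eqOn_halfPlane_of_eqOn_right`, `differentiableOn_partialPairL_of_isSatakeFamilyOf`), then
`MoeglinWaldspurger1989_partialPairL_entire_of_rank_ne_of_entire_quotients`. [cite: CogdellAnalyticTheory2004, Thm. 4.2 and §4.2] -/
theorem partialPairL_entire_of_gap
    (hA : ∀ (N M : ℕ) (K : Type) [Field K] [NumberField K], JacquetShalika1990_archRankinSelbergGap_entireRatio N M K)
    (hE : ∀ (N M : ℕ) (K : Type) [Field K] [NumberField K], Cogdell2004_unfoldedPairIntegral_entire N M K)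
    {n m : ℕ} {K : Type} [Field K] [NumberField K]
    {μ : Measure (gl n K).automorphicQuotient} [(gl n K).IsAutomorphicMeasure μ]
    {μ' : Measure (gl m K).automorphicQuotient} [(gl m K).IsAutomorphicMeasure μ'] (hgap : m + 2 ≤ n) :
    MoeglinWaldspurger1989_partialPairL_entire_of_rank_ne (n := n) (m := m) (K := K) (μ := μ)
      (μ' := μ') := by
  refine MoeglinWaldspurger1989_partialPairL_entire_of_rank_ne_of_entire_quotients fun _hnm _hn hm P P' => ?_
  classical
  have hmn : m < n := by omega
  -- the ramified set of the pair and the canonical Satake families off it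
  obtain ⟨α₀, β₀, hα₀', hβ₀'⟩ := exists_isSatakeFamilyOf_pair_ramified P P'
  have hS₀f : {v : HeightOneSpectrum (𝓞 K) | ¬ IsUnramifiedAt P.1 v ∨ ¬ IsUnramifiedAt P'.1 v}.Finite :=
    finite_setOf_not_isUnramifiedAt_or P P'
  obtain ⟨S₀, hcoe⟩ : ∃ S₀ : Finset (HeightOneSpectrum (𝓞 K)),
      (↑S₀ : Set (HeightOneSpectrum (𝓞 K))) = {v | ¬ IsUnramifiedAt P.1 v ∨ ¬ IsUnramifiedAt P'.1 v} :=
    ⟨hS₀f.toFinset, hS₀f.coe_toFinset⟩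
  have hmemS₀ : ∀ v : HeightOneSpectrum (𝓞 K), v ∈ S₀ ↔ ¬ IsUnramifiedAt P.1 v ∨ ¬ IsUnramifiedAt P'.1 v :=
    fun v => by rw [← Finset.mem_coe, hcoe, Set.mem_setOf_eq]
  have hα₀ : IsSatakeFamilyOf P (↑S₀ : Set (HeightOneSpectrum (𝓞 K))) α₀ := hα₀'.mono hcoe.symm.subset
  have hβ₀ : IsSatakeFamilyOf P' (↑S₀ : Set (HeightOneSpectrum (𝓞 K))) β₀ := hβ₀'.mono hcoe.symm.subset
  have hram : ∀ v ∈ (↑S₀ : Set (HeightOneSpectrum (𝓞 K))), ¬ IsUnramifiedAt P.1 v ∨ ¬ IsUnramifiedAt P'.1 v :=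
    fun v hv => (hmemS₀ v).1 (Finset.mem_coe.1 hv)
  have hU : ∀ v ∉ S₀, IsUnramifiedAt P.1 v ∧ IsUnramifiedAt P'.1 v := fun v hv =>
    ⟨of_not_not fun h => hv ((hmemS₀ v).2 (Or.inl h)), of_not_not fun h => hv ((hmemS₀ v).2 (Or.inr h))⟩
  refine ⟨↑S₀, α₀, β₀, hram, hα₀, hβ₀, 1, fun s₀ => ?_⟩
  obtain ⟨x₀, J, A, hJ, hA, hA0, hJA⟩ :=
    gap_entire_quotient_of_local_control hA hE hm hmn P P' S₀ hU hα₀ hβ₀ s₀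
  refine ⟨J, A, hJ, hA, hA0, ?_⟩
  have hL := differentiableOn_partialPairL_of_isSatakeFamilyOf P P' hα₀ hβ₀
  have hAL : DifferentiableOn ℂ (fun s => A s * partialPairL (↑S₀ : Set (HeightOneSpectrum (𝓞 K))) α₀ β₀ s)
      {s : ℂ | 1 < s.re} := hA.differentiableOn.mul hL
  exact eqOn_halfPlane_of_eqOn_right hJ hAL (le_max_right x₀ 1)
    fun s hs => hJA s (lt_of_le_of_lt (le_max_left _ _) hs)


/-- **The crux `PairLBoundaryJS` (Arthur–Clozel (2.2) for Borel–Jacquet data, all ranks) from FOUR named facts**: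
the equal-rank archimedean fact of Humphries–Jo (`hHJ`), the corner archimedean fact of Jacquet (`hJ`), the
archimedean gap fact (`hA`) and the analytic clause of Cogdell (2004), Thm. 2.1 (`hE`) — Mœglin–Waldspurger (i)(a)
for `m + 2 ≤ n` being supplied by `partialPairL_entire_of_gap hA hE`, everything else by
`PairLBoundaryJSOfCornerRoad.stub_PairLBoundaryJS_of_gap_of_humphriesJo_of_jacquet`.
[cite: ArthurClozelAMS120, Ch. 3 §2 (2.2)] [cite: MoeglinWaldspurger1989, Appendice, Corollaire (i)(a), p. 667]
[cite: CogdellAnalyticTheory2004, Thm. 2.1 and Thm. 4.2] -/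
theorem stub_PairLBoundaryJS_of_four_facts :
    (∀ (N : ℕ) (K : Type) [Field K] [NumberField K], HumphriesJo2024_archRankinSelberg_testVector N K) →
    (∀ (N : ℕ) (K : Type) [Field K] [NumberField K],
      JacquetArchimedeanRS2009_archRankinSelbergCorner_testVector N K) →
    (∀ (N M : ℕ) (K : Type) [Field K] [NumberField K], JacquetShalika1990_archRankinSelbergGap_entireRatio N M K) →
    (∀ (N M : ℕ) (K : Type) [Field K] [NumberField K], Cogdell2004_unfoldedPairIntegral_entire N M K) →
    Summit.Langlands.Langlands.Theses.IrreducibilityBySelfDuality.PairLBoundaryJS :=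
  fun hHJ hJ hA hE =>
    PairLBoundaryJSOfCornerRoad.stub_PairLBoundaryJS_of_gap_of_humphriesJo_of_jacquet
      (fun h => partialPairL_entire_of_gap hA hE h) hHJ hJ

end Summit.Langlands.Langlands.Theorems.PairLBoundaryJSOfGapRoad

end
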